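import Mathlib
import HarnessLib
import Summits.NavierStokesRegularity.NavierStokesRegularity.Theorems.HalfSpaceWindowDoorCirculationCarryingRigidityConeFluxSubsolution
import Summits.NavierStokesRegularity.NavierStokesRegularity.Theorems.HalfSpaceWindowDoorCirculationCarryingRigidityGaussExtremalTilting
import Literature.Analysis.FluidPDE.MeridianReduction
import Literature.Analysis.FluidPDE.KNSSSwirlTransport
import Literature.Analysis.FluidPDE.AxisymQuotientEquations

/-!
# Route `HalfSpaceWindowDoor`, crux `CirculationCarryingRigidity` (stmt-NavierStokesRegularity-25311) —
# line `cone_sweep`, RADIAL form, Step 1: the circle term needs only the RADIAL vorticity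

LEAD ns-hsw-p1 g9, `--supports stmt-NavierStokesRegularity-25311 --as helper`; card `Cruxes/…/Lines/cone_sweep.md`.  In LRT's circle term
`T = ∮(v_rω₃ − ω_r v₃) dl` only the RADIAL vorticity `ω_r = ⟪ω, e_r⟫` is tilted: `|(v_rω₃ − ω_r v₃)r| ≤ B(ω₃ r + |ω_r| r)`
(`abs_circleTerm_integrand_le_rad`), hence on a circle carrying the RADIAL circle cone `∮|ω_r| dl ≤ K∮ω₃ dl` the flux is a subsolution input:
`−T ≤ (C(1+K)/√(−s))∮ω₃ dl` (`neg_circleTerm_le_rad`).  Consumed by `…RadConeSweeping`.  No NS regularity claim; no item closed.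
-/

noncomputable section

-- the summit and its single sub-problem share the name (CONVENTIONS §1), as in every Theorems file
set_option linter.dupNamespace false

namespace Summit.NavierStokesRegularity.NavierStokesRegularity.Theorems.HalfSpaceWindowDoorCirculationCarryingRigidityRadConeFlux

open MeasureTheory Set Function Filter Topology InnerProductSpace
open scoped RealInnerProductSpace InnerProductSpace Laplacian
open Literature.Analysis Literature.Analysis.UnboundedOperators
open Literature.Analysis.FluidPDE hiding eR
open Summit.NavierStokesRegularity.NavierStokesRegularity.Theses.HalfSpaceWindowDoor
open Summit.NavierStokesRegularity.NavierStokesRegularity.Theorems.HalfSpaceWindowDoorCirculationCarryingRigidityDefs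
  (InDoorClass SignE3 e3)
open Summit.NavierStokesRegularity.NavierStokesRegularity.Theorems.AxisTwistDoorAveragedConeLiouvilleDefs
  (cylPt eT eR circ vortCirc tiltCirc circleTerm)
open Summit.NavierStokesRegularity.NavierStokesRegularity.Theorems.AveragedConeLiouville.CircleStokes (continuous_eR)
open Summit.NavierStokesRegularity.NavierStokesRegularity.Theorems.AxisTwistDoorAveragedConeLiouvilleCylFrame
  (continuous_cylPt_θ abs_inner_eR_le abs_inner_e3_le abs_integral_le_const_mul_add)
open Summit.NavierStokesRegularity.NavierStokesRegularity.Theorems.AveragedConeLiouville.CircleStokes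
  (deriv_circ_eq_vortCirc)
open Summit.NavierStokesRegularity.NavierStokesRegularity.Theorems.AveragedConeLiouville.CircMonotone
  (circ_zero circ_mono circ_nonneg vortCirc_nonneg)
open Summit.NavierStokesRegularity.NavierStokesRegularity.Theorems.HalfSpaceWindowDoorCirculationCarryingRigidityAxisCirculation
  (contDiff_circF isSmoothSpaceTimeOn_circF isSmoothSpaceTimeOn_of_class fderiv_circF_eR laplacian_circF hasDerivAt_circF_time)
open Summit.NavierStokesRegularity.NavierStokesRegularity.Theorems.HalfSpaceWindowDoorCirculationCarryingRigidityAxisCirculationDynamics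
  (abs_circleTerm_le_cone deriv_circ_s_eq)
open Summit.NavierStokesRegularity.NavierStokesRegularity.Theorems.PoloidalWindowDoorPoloidalWindowRigidityClassSpaceTimeRates
  (exists_fderiv_rate_of_class')

open Summit.NavierStokesRegularity.NavierStokesRegularity.Theorems.HalfSpaceWindowDoorCirculationCarryingRigidityConeFluxSubsolution

variable {C : ℝ} {v : ℝ → EuclideanSpace ℝ (Fin 3) → EuclideanSpace ℝ (Fin 3)}

/-- Pointwise bound of the circle-term integrand by the VERTICAL and RADIAL vorticity only:
`|(v_r ω₃ − ω_r v₃) r| ≤ B (ω₃ r + |ω_r| r)` for `‖v‖ ≤ B`, `ω₃ ≥ 0`. -/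
theorem abs_circleTerm_integrand_le_rad (w q : EuclideanSpace ℝ (Fin 3)) {θ r B : ℝ} (hr : 0 ≤ r) (hw : ‖w‖ ≤ B)
    (hq : 0 ≤ ⟪q, Summit.NavierStokesRegularity.NavierStokesRegularity.Theorems.AxisTwistDoorAveragedConeLiouvilleDefs.e3⟫) :
    |(⟪w, eR θ⟫ * ⟪q, Summit.NavierStokesRegularity.NavierStokesRegularity.Theorems.AxisTwistDoorAveragedConeLiouvilleDefs.e3⟫ -
        ⟪q, eR θ⟫ * ⟪w, Summit.NavierStokesRegularity.NavierStokesRegularity.Theorems.AxisTwistDoorAveragedConeLiouvilleDefs.e3⟫) * r| ≤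
      B * (⟪q, Summit.NavierStokesRegularity.NavierStokesRegularity.Theorems.AxisTwistDoorAveragedConeLiouvilleDefs.e3⟫ * r +
        |⟪q, eR θ⟫| * r) := by
  have h1 : |⟪w, eR θ⟫| ≤ B := (abs_inner_eR_le w θ).trans hw
  have h2 : |⟪w, Summit.NavierStokesRegularity.NavierStokesRegularity.Theorems.AxisTwistDoorAveragedConeLiouvilleDefs.e3⟫| ≤ B :=
    (abs_inner_e3_le w).trans hw
  have hB : 0 ≤ B := (norm_nonneg w).trans hw
  rw [abs_mul, abs_of_nonneg hr]
  have h4 : |⟪w, eR θ⟫ * ⟪q, Summit.NavierStokesRegularity.NavierStokesRegularity.Theorems.AxisTwistDoorAveragedConeLiouvilleDefs.e3⟫ -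
      ⟪q, eR θ⟫ * ⟪w, Summit.NavierStokesRegularity.NavierStokesRegularity.Theorems.AxisTwistDoorAveragedConeLiouvilleDefs.e3⟫| ≤
      B * ⟪q, Summit.NavierStokesRegularity.NavierStokesRegularity.Theorems.AxisTwistDoorAveragedConeLiouvilleDefs.e3⟫ + |⟪q, eR θ⟫| * B := by
    refine (abs_sub _ _).trans ?_
    rw [abs_mul, abs_mul, abs_of_nonneg hq]
    have h5 : |⟪q, eR θ⟫| * |⟪w, Summit.NavierStokesRegularity.NavierStokesRegularity.Theorems.AxisTwistDoorAveragedConeLiouvilleDefs.e3⟫|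
        ≤ |⟪q, eR θ⟫| * B := mul_le_mul_of_nonneg_left h2 (abs_nonneg _)
    have h6 : |⟪w, eR θ⟫| * ⟪q, Summit.NavierStokesRegularity.NavierStokesRegularity.Theorems.AxisTwistDoorAveragedConeLiouvilleDefs.e3⟫
        ≤ B * ⟪q, Summit.NavierStokesRegularity.NavierStokesRegularity.Theorems.AxisTwistDoorAveragedConeLiouvilleDefs.e3⟫ :=
      mul_le_mul_of_nonneg_right h1 hq
    linarith
  calc |⟪w, eR θ⟫ * ⟪q, Summit.NavierStokesRegularity.NavierStokesRegularity.Theorems.AxisTwistDoorAveragedConeLiouvilleDefs.e3⟫ -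
        ⟪q, eR θ⟫ * ⟪w, Summit.NavierStokesRegularity.NavierStokesRegularity.Theorems.AxisTwistDoorAveragedConeLiouvilleDefs.e3⟫| * r
      ≤ (B * ⟪q, Summit.NavierStokesRegularity.NavierStokesRegularity.Theorems.AxisTwistDoorAveragedConeLiouvilleDefs.e3⟫ + |⟪q, eR θ⟫| * B) * r :=
        mul_le_mul_of_nonneg_right h4 hr
    _ = B * (⟪q, Summit.NavierStokesRegularity.NavierStokesRegularity.Theorems.AxisTwistDoorAveragedConeLiouvilleDefs.e3⟫ * r + |⟪q, eR θ⟫| * r) := by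
        ring

/-- **Step 1, radial form**: on a circle carrying the RADIAL circle cone `∮|ω_r| dl ≤ K∮ω₃ dl`, `−T ≤ (C(1+K)/√(−s))·∮ω₃ dl`. -/
theorem neg_circleTerm_le_rad (hv : InDoorClass C v) (hsign : SignE3 v) {K s r : ℝ} {z : ℝ}
    (hcone : (∫ θ in (0 : ℝ)..(2 * Real.pi), |⟪curl (v s) (cylPt r θ z), eR θ⟫| * r) ≤ K * vortCirc v r z s) (hs : s < 0)
    (hr : 0 ≤ r) : -circleTerm v r z s ≤ C * (1 + K) / Real.sqrt (-s) * vortCirc v r z s := by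
  have hsq : 0 < Real.sqrt (-s) := Real.sqrt_pos.2 (neg_pos.2 hs)
  have hC : 0 ≤ C := HalfSpaceWindowDoorCirculationCarryingRigidityConeFluxSubsolution.typeI_const_nonneg hv
  have hv1 := contDiff_one_slice hv hs
  have hB0 : 0 ≤ C / Real.sqrt (-s) := div_nonneg hC hsq.le
  have hvc : Continuous fun θ => v s (cylPt r θ z) := hv1.continuous.comp (continuous_cylPt_θ r z)
  have hωc : Continuous fun θ => curl (v s) (cylPt r θ z) := by
    have hD : Continuous (fderiv ℝ (v s)) := hv1.continuous_fderiv one_ne_zero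
    have e : curl (v s) = fun x => curlCLM (fderiv ℝ (v s) x) := by funext x; exact curl_eq_curlCLM (v s) x
    rw [e]
    exact (curlCLM.continuous.comp hD).comp (continuous_cylPt_θ r z)
  have hf : Continuous fun θ => (⟪v s (cylPt r θ z), eR θ⟫ *
      ⟪curl (v s) (cylPt r θ z), Summit.NavierStokesRegularity.NavierStokesRegularity.Theorems.AxisTwistDoorAveragedConeLiouvilleDefs.e3⟫
      - ⟪curl (v s) (cylPt r θ z), eR θ⟫ *
        ⟪v s (cylPt r θ z), Summit.NavierStokesRegularity.NavierStokesRegularity.Theorems.AxisTwistDoorAveragedConeLiouvilleDefs.e3⟫) * r :=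
    (((hvc.inner continuous_eR).mul (hωc.inner continuous_const)).sub
      ((hωc.inner continuous_eR).mul (hvc.inner continuous_const))).mul continuous_const
  have hg1 : Continuous fun θ =>
      ⟪curl (v s) (cylPt r θ z), Summit.NavierStokesRegularity.NavierStokesRegularity.Theorems.AxisTwistDoorAveragedConeLiouvilleDefs.e3⟫ * r :=
    (hωc.inner continuous_const).mul continuous_const
  have hg2 : Continuous fun θ => |⟪curl (v s) (cylPt r θ z), eR θ⟫| * r := ((hωc.inner continuous_eR).abs).mul continuous_const
  have h := abs_integral_le_const_mul_add hf hg1 hg2 fun θ =>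
    abs_circleTerm_integrand_le_rad (v s (cylPt r θ z)) (curl (v s) (cylPt r θ z)) hr (hv.1 s hs _)
      (signE3_atd hsign s hs (cylPt r θ z))
  have h2 : -circleTerm v r z s ≤ |circleTerm v r z s| := neg_le_abs _
  have h3 : |circleTerm v r z s| ≤ C / Real.sqrt (-s) *
      (vortCirc v r z s + ∫ θ in (0 : ℝ)..(2 * Real.pi), |⟪curl (v s) (cylPt r θ z), eR θ⟫| * r) := h
  have h4 : C / Real.sqrt (-s) * (vortCirc v r z s + ∫ θ in (0 : ℝ)..(2 * Real.pi), |⟪curl (v s) (cylPt r θ z), eR θ⟫| * r) ≤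
      C / Real.sqrt (-s) * (vortCirc v r z s + K * vortCirc v r z s) :=
    mul_le_mul_of_nonneg_left (by linarith) hB0
  calc -circleTerm v r z s ≤ C / Real.sqrt (-s) * (vortCirc v r z s + K * vortCirc v r z s) := h2.trans (h3.trans h4)
    _ = C * (1 + K) / Real.sqrt (-s) * vortCirc v r z s := by ring

end Summit.NavierStokesRegularity.NavierStokesRegularity.Theorems.HalfSpaceWindowDoorCirculationCarryingRigidityRadConeFlux

end
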